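import Literature.AlgebraicGeometry.Limits.LocalizationIsoSpread              -- ★ `LocApprox.exists_pullback_iso_of_pullback_iso`
import Literature.AlgebraicGeometry.Smoothening.ProjectiveModel               -- ★ `Smoothening.nonempty_projectiveModel`
import Literature.AlgebraicGeometry.Morphisms.ProjectiveMorphismComposition   -- ★ `IsProjective.pullback_snd`, `comp_isClosedImmersion`
import Literature.AlgebraicGeometry.Morphisms.ProjectiveSpaceOverAffine       -- ★ `isPullback_projToSpec_projMap_terminal`
import Literature.AlgebraicGeometry.Motives.IntegralModelOfGlobalModel        -- ★ `IntegralModel.localise` (A-p03)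
import HarnessLib

/-!
# Limits of schemes: a PROJECTIVE generic fibre spreads to a projective family — unit form, stage-free, and the
# «almost all primes» reading for global integral models (EGA IV₃ 8.10.5 (xiii); Stacks 081F ∕ 0C0C pattern)

Topic `Literature/AlgebraicGeometry/Limits`; namespace `Literature.AlgebraicGeometry.Limits`.  THEOREMS ONLY (no definition, no named
fact, no instance, no notation, no `sorry`).  Cell `hodgecm-mathlib`, P6 «MOD programme», P6a ED.-2 census 8396c07d §3∕§4 hand PROJ-SPREAD =
`stub_PROJ : ProjectiveSpreadCofinite` of `Lines/F0_P6a_ModuliDatum.lean` (the «UP a PROJECTIVE `𝓨` over `Spec 𝒪_{F,(w)}`» input of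
hand M-A's `_hcovθ`).  HC_CM is proved only modulo the printed citations until rung 0 closes; nothing here is about HC.

THE MATHEMATICS ([EGAIV3] Thm. 8.10.5 (xiii) «projectif»; [GortzWedhorn2020] Cor. 10.64 (2); [StacksProject] Tags 081F, 0C0C for the cofinite
reading).  Let `A` be a Noetherian domain with fraction field `K` and `P → Spec A` a quasi-compact quasi-separated `A`-scheme locally of finite
presentation whose generic fibre `P ⊗_A K` is PROJECTIVE over `K` (a closed `K`-subscheme of some `ℙⁿ_K`).  The scheme-theoretic closure of
`P ⊗_A K ⊂ ℙⁿ_K ⊂ ℙⁿ_A` is a projective model `P′ → Spec A` with the SAME generic fibre (★ `Smoothening.nonempty_projectiveModel`, Stacks 081I);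
two finitely presented `A`-schemes with isomorphic generic fibres are isomorphic over some stage `Spec A[1∕t]`, `t ≠ 0` (★
`LocApprox.exists_pullback_iso_of_pullback_iso`, [GortzWedhorn2020] Cor. 10.64 (2)); projectivity is stable under base change (★
`IsProjective.pullback_snd`) and under isomorphisms of the source over the base (★ `IsProjective.comp_isClosedImmersion`); hence
`P ⊗_A T → Spec T` is projective for EVERY commutative `A`-algebra `T` in which `t` is a unit (base change along `Spec T → Spec A[1∕t]`).
Over a Dedekind domain (e.g. `A = 𝓞 F`) the element `t` lies in only finitely many height-one primes (Mathlib `Ideal.finite_factors`;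
the tree's ★ `Literature.RingTheory.DedekindDomain.eventually_not_mem_asIdeal`),
so the localisation `𝒳.localise w` (★ `IntegralModel.localise`) of a finitely presented GLOBAL model `𝒳` of a projective `F`-scheme is
PROJECTIVE over `Spec 𝒪_{F,(w)}` for all but finitely many `w`.

MAIN STATEMENTS.
* `isProjective_comp_projToSpec` — a closed subscheme of `Proj A[x₀,…,x_m]` is projective over `Spec A` in Hartshorne's sense (★
  `Morphisms.IsProjective`, via ★ `isPullback_projToSpec_projMap_terminal`); `ProjectiveModel.isProjective_hom`;
* **`LocApprox.exists_forall_isProjective_snd_of_isUnit`** — the unit form: `∃ s ∈ A⁰, ∀ T, IsUnit (s : T) → IsProjective (P ⊗_A T → Spec T)`;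
* **`LocApprox.eventually_isProjective_snd_atPrime`** — the cofinite reading over a Dedekind domain, for every model `T` of `A_v`;
* **`IntegralModel.eventually_isProjective_localise`** — `∀ᶠ w, IsProjective (𝒳.localise w).total.hom` for a global model `𝒳` over `𝓞 F`
  of a projective `F`-scheme (= the letter `ProjectiveSpreadCofinite`, up to its binder order).

## References
* [EGAIV3] A. Grothendieck, *EGA* IV₃, Publ. Math. IHÉS 28 (1966), Thm. 8.10.5 (xiii).
* [GortzWedhorn2020] U. Görtz, T. Wedhorn, *Algebraic Geometry I* (2nd ed.), Cor. 10.64 (2) (p. 329); §(13.15) (pp. 404–406) (projective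
  morphisms, base change).
* [StacksProject] The Stacks Project, Tags 081F, 0C0C (spreading over a cofinite set of primes), 081I (scheme-theoretic closure model).
* [Hartshorne1977] R. Hartshorne, *Algebraic Geometry*, II §4 Definition p. 103 (projective morphism).
-/

noncomputable section

universe u

-- Mathlib's pull-back API is stated through `abbrev`s over `limit` (as in the tree's `Limits/*` files).
set_option backward.isDefEq.respectTransparency false

open CategoryTheory CategoryTheory.Limits AlgebraicGeometry IsDedekindDomain
open scoped NumberField
open Literature.AlgebraicGeometry.Morphisms (IsProjective)

namespace Literature.AlgebraicGeometry.Limits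

open Literature.AlgebraicGeometry.Motives (SchemeOver specOver IsProjectiveOver IntegralModel)
open Literature.AlgebraicGeometry.Morphisms Literature.AlgebraicGeometry.Smoothening

attribute [local instance] MvPolynomial.gradedAlgebra

/-! ## §1 Closed subschemes of `Proj A[x₀, …, x_m]` are projective over `Spec A` -/

/-- **A closed subscheme of `ℙᵐ_A = Proj A[x₀,…,x_m]` is projective over `Spec A`** in Hartshorne's sense (★ `Morphisms.IsProjective`: a
closed immersion into `𝐏(ι; Spec A) = Spec A × 𝐏^ι_ℤ` followed by the projection), through the comparison `Proj A[x] ≅ 𝐏(ι; Spec A)` of ★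
`isPullback_projToSpec_projMap_terminal` (`#ι = m`). [cite: Hartshorne1977, II §4 Definition p.103 (projective morphism)]
[cite: GortzWedhorn2020, Section (4.12) (p. 113)] -/
theorem isProjective_comp_projToSpec {A : Type u} [CommRing A] {m : ℕ} {P : Scheme.{u}}
    (emb : P ⟶ Proj (MvPolynomial.homogeneousSubmodule (Fin (m + 1)) A)) [IsClosedImmersion emb] :
    IsProjective (emb ≫ Motives.ProjBaseChangeRing.projToSpec (Fin (m + 1)) A) := by
  letI : Algebra intU.{u} A := ULift.algebra' ℤ A
  obtain ⟨ι, hι, hm⟩ : ∃ (ι : Type u) (_ : Finite ι), Nat.card ι = m :=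
    ⟨ULift.{u} (Fin m), inferInstance, by rw [Nat.card_ulift, Nat.card_fin]⟩
  subst hm
  refine ⟨ι, hι, emb ≫ (isPullback_projToSpec_projMap_terminal ι A).isoPullback.hom, inferInstance, ?_⟩
  rw [Category.assoc, projectiveSpaceSpec_isoPullback_hom_fst]

/-- **The structure morphism of a projective model is projective.** [cite: Hartshorne1977, II §4 Definition p.103 (projective morphism)] -/
theorem ProjectiveModel.isProjective_hom {A K : Type u} [CommRing A] [Field K] [Algebra A K] {E : SchemeOver K}
    (M : ProjectiveModel A K E) : IsProjective M.hom :=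
  isProjective_comp_projToSpec M.emb

/-! ## §2 From the stage `Spec A[1∕t]` to every `T` in which `t` is a unit -/

section Unit

variable {A : Type u} [CommRing A]

/-- **Projectivity passes from `X ×_Y Y′ → Y′` to `X ×_Y T → T` when `T → Y` factors through `Y′`** (it is then a base change of the former,
up to the pasting isomorphism ★ Mathlib `pullbackLeftPullbackSndIso`). [cite: GortzWedhorn2020, §(13.15) (pp. 404–406)] -/
theorem isProjective_snd_of_comp_eq {X Y Y' T : Scheme.{u}} (f : X ⟶ Y) (j : Y' ⟶ Y)
    (hW : IsProjective (pullback.snd f j)) {i : T ⟶ Y} (e : T ⟶ Y') (he : e ≫ j = i) :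
    IsProjective (pullback.snd f i) := by
  subst he
  have h : IsProjective (pullback.snd (pullback.snd f j) e) := hW.pullback_snd e
  rw [← pullbackLeftPullbackSndIso_inv_snd_snd f j e]
  exact h.comp_isClosedImmersion _

/-- **From the stage `A[1∕s]` to every `T` inverting `s`**: if `P ×_A Spec L → Spec L` is projective for a model `L` of `A[1∕s]`, so is
`P ×_A Spec T → Spec T` for every commutative `A`-algebra `T` in which `s` is a unit (`Spec T → Spec A` factors through `Spec L`, Mathlib
`IsLocalization.Away.lift`). [cite: GortzWedhorn2020, §(13.15) (pp. 404–406)] -/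
theorem isProjective_snd_of_stage_of_isUnit (P : SchemeOver A) (s : A) (L : Type u) [CommRing L] [Algebra A L]
    [IsLocalization.Away s L] (hW : IsProjective (pullback.snd P.hom (Spec.map (CommRingCat.ofHom (algebraMap A L)))))
    (T : Type u) [CommRing T] [Algebra A T] (hs : IsUnit (algebraMap A T s)) :
    IsProjective (pullback.snd P.hom (Spec.map (CommRingCat.ofHom (algebraMap A T)))) := by
  refine isProjective_snd_of_comp_eq P.hom _ hW (Spec.map (CommRingCat.ofHom (IsLocalization.Away.lift s hs))) ?_
  rw [← Spec.map_comp, ← CommRingCat.ofHom_comp, IsLocalization.Away.lift_comp]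

end Unit

/-! ## §3 The unit form: a projective generic fibre spreads to a projective family -/

section UnitForm

variable {A : Type u} [CommRing A] [IsNoetherianRing A]
  (K : Type u) [Field K] [Algebra A K] [IsFractionRing A K]

/-- Over a locally Noetherian base, locally of finite type implies locally of finite presentation (chartwise Mathlib
`RingHom.FinitePresentation.of_finiteType`). [cite: GortzWedhorn2020, Prop. 10.75 (1) and (10.13)] -/
private theorem locallyOfFinitePresentation_of_isLocallyNoetherian' {X Y : Scheme.{u}} (g : X ⟶ Y)
    [IsLocallyNoetherian Y] [LocallyOfFiniteType g] : LocallyOfFinitePresentation g := by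
  rw [HasRingHomProperty.iff_appLE (P := @LocallyOfFinitePresentation)]
  intro U V e
  haveI := IsLocallyNoetherian.component_noetherian (X := Y) U
  exact RingHom.FinitePresentation.of_finiteType.mp
    (HasRingHomProperty.appLE @LocallyOfFiniteType g inferInstance U V e)

/-- **A PROJECTIVE generic fibre spreads to a PROJECTIVE family — unit form** ([EGAIV3] 8.10.5 (xiii); [GortzWedhorn2020] Cor. 10.64 (2)):
`A` Noetherian with fraction field `K`, `P → Spec A` quasi-compact, quasi-separated, locally of finite presentation, with `P ⊗_A K`
projective over `K`.  Then there is `s ∈ A⁰` such that `P ⊗_A T → Spec T` is projective for every commutative `A`-algebra `T` in which `s` is a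
unit.  Proof: the scheme-theoretic-closure model `P′ ⊂ ℙⁿ_A` of the generic fibre (★ `nonempty_projectiveModel`) is projective with the same
generic fibre; `P ⊗ A[1∕t] ≅ P′ ⊗ A[1∕t]` over `Spec A[1∕t]` for some `t ≠ 0` (★ `exists_pullback_iso_of_pullback_iso`); projectivity transfers
along the isomorphism and along `Spec T → Spec A[1∕t]`. [cite: EGAIV3, Thm. 8.10.5 (xiii)] [cite: GortzWedhorn2020, Cor. 10.64 (2), p. 329] -/
theorem LocApprox.exists_forall_isProjective_snd_of_isUnit (P : SchemeOver A) [QuasiCompact P.hom]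
    [QuasiSeparated P.hom] [LocallyOfFinitePresentation P.hom]
    (hproj : IsProjectiveOver ((Over.pullback (specOver A K).hom).obj P)) :
    ∃ s ∈ nonZeroDivisors A, ∀ (T : Type u) [CommRing T] [Algebra A T],
      IsUnit (algebraMap A T s) →
        IsProjective (pullback.snd P.hom (Spec.map (CommRingCat.ofHom (algebraMap A T)))) := by
  classical
  -- the projective model `P′` of the generic fibre `E`
  obtain ⟨M⟩ := nonempty_projectiveModel A K ((Over.pullback (specOver A K).hom).obj P) hproj
  let P' : SchemeOver A := Over.mk M.hom
  haveI : IsProper P'.hom := M.isProper_hom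
  haveI : IsNoetherianRing (CommRingCat.of A) := ‹IsNoetherianRing A›
  haveI : IsLocallyNoetherian (Spec (CommRingCat.of A)) := (isLocallyNoetherian_Spec (R := CommRingCat.of A)).mpr ‹_›
  haveI : LocallyOfFiniteType P'.hom := ‹IsProper P'.hom›.toLocallyOfFiniteType
  haveI : LocallyOfFinitePresentation P'.hom := locallyOfFinitePresentation_of_isLocallyNoetherian' P'.hom
  haveI : QuasiCompact P'.hom := inferInstance
  haveI : QuasiSeparated P'.hom := inferInstance
  -- the two models have isomorphic generic fibres
  let k : (Over.pullback (specOver A K).hom).obj P ≅ (Over.pullback (specOver A K).hom).obj P' :=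
    Over.isoMk M.isPullback.isoPullback (M.isPullback.isoPullback_hom_snd)
  -- hence are isomorphic over some stage `Spec A[1/t]`
  obtain ⟨t, ⟨e⟩⟩ := LocApprox.exists_pullback_iso_of_pullback_iso (S := nonZeroDivisors A) (B := K) k
  refine ⟨t.val, t.mem, fun T _ _ hT => ?_⟩
  -- projectivity of `P′` over the stage, transferred to `P` along `e`
  have hP' : IsProjective (pullback.snd P'.hom (Spec.map (CommRingCat.ofHom (algebraMap A (loc (nonZeroDivisors A) t))))) :=
    (ProjectiveModel.isProjective_hom M).pullback_snd _
  have hP : IsProjective (pullback.snd P.hom (Spec.map (CommRingCat.ofHom (algebraMap A (loc (nonZeroDivisors A) t))))) := by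
    have hw : e.hom.left ≫ pullback.snd P'.hom (Spec.map (CommRingCat.ofHom (algebraMap A (loc (nonZeroDivisors A) t)))) =
        pullback.snd P.hom (Spec.map (CommRingCat.ofHom (algebraMap A (loc (nonZeroDivisors A) t)))) := Over.w e.hom
    rw [← hw]
    exact hP'.comp_isClosedImmersion _
  exact isProjective_snd_of_stage_of_isUnit P t.val (loc (nonZeroDivisors A) t) hP T hT

end UnitForm

/-! ## §4 Dedekind bases: projective over `A_v` for all but finitely many primes `v` -/

section Dedekind

variable {A : Type u} [CommRing A] [IsDedekindDomain A] (K : Type u) [Field K] [Algebra A K] [IsFractionRing A K]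

/-- A non-zero element of a Dedekind domain lies in only finitely many height-one primes (Mathlib `Ideal.finite_factors`; private copy of
the tree's public ★ `Literature.RingTheory.DedekindDomain.eventually_not_mem_asIdeal`, kept local to spare an import). [folklore] -/
private theorem eventually_not_mem' {s : A} (hs : s ≠ 0) :
    ∀ᶠ v : HeightOneSpectrum A in Filter.cofinite, s ∉ v.asIdeal := by
  rw [Filter.eventually_cofinite]
  refine (Ideal.finite_factors (I := Ideal.span {s}) ?_).subset ?_
  · simpa [Ideal.span_singleton_eq_bot] using hs
  · intro v hv
    simpa [Ideal.dvd_span_singleton] using hv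

/-- **A projective generic fibre ⇒ `P ⊗_A T → Spec T` projective for every model `T` of `A_v`, for all but finitely many height-one primes `v`
of the Dedekind domain `A`** (the unit form + finiteness of the primes containing `s`). [cite: StacksProject, Tags 081F, 0C0C]
[cite: EGAIV3, Thm. 8.10.5 (xiii)] -/
theorem LocApprox.eventually_isProjective_snd_atPrime (P : SchemeOver A) [QuasiCompact P.hom] [QuasiSeparated P.hom]
    [LocallyOfFinitePresentation P.hom] (hproj : IsProjectiveOver ((Over.pullback (specOver A K).hom).obj P)) :
    ∀ᶠ v : HeightOneSpectrum A in Filter.cofinite,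
      ∀ (T : Type u) [CommRing T] [Algebra A T] [IsLocalization.AtPrime T v.asIdeal],
        IsProjective (pullback.snd P.hom (Spec.map (CommRingCat.ofHom (algebraMap A T)))) := by
  obtain ⟨s, hsS, H⟩ := LocApprox.exists_forall_isProjective_snd_of_isUnit K P hproj
  filter_upwards [eventually_not_mem' (nonZeroDivisors.ne_zero hsS)] with v hv T _ _ _
  exact H T (IsLocalization.map_units T ⟨s, show s ∈ v.asIdeal.primeCompl from hv⟩)

end Dedekind

/-! ## §5 Number fields: the localisations of a global model of a projective `F`-scheme are projective for almost all `w` -/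

section NumberField

variable {F : Type} [Field F] [NumberField F] {X : SchemeOver F}

/-- **Letter `ProjectiveSpreadCofinite` (P6a ED. 2, `stub_PROJ`)**: for `X` projective over `F` and a GLOBAL integral model `𝒳` of `X` over
`𝓞 F` with `𝒳.total.hom` quasi-compact, quasi-separated and locally of finite presentation, the localisation `𝒳.localise w` (★
`IntegralModel.localise`) is PROJECTIVE over `Spec 𝒪_{F,(w)}` for all but finitely many `w`. [cite: StacksProject, Tags 081F, 0C0C]
[cite: EGAIV3, Thm. 8.10.5 (xiii)] -/
theorem IntegralModel.eventually_isProjective_localise (𝒳 : IntegralModel (𝓞 F) F X)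
    [QuasiCompact 𝒳.total.hom] [QuasiSeparated 𝒳.total.hom] [LocallyOfFinitePresentation 𝒳.total.hom]
    (hX : IsProjectiveOver X) :
    ∀ᶠ w : HeightOneSpectrum (𝓞 F) in Filter.cofinite, IsProjective (𝒳.localise w).total.hom := by
  -- the generic fibre of `𝒳.total` is projective: transport `hX` along `𝒳.genericIso`
  have hgen : IsProjectiveOver ((Over.pullback (specOver (𝓞 F) F).hom).obj 𝒳.total) := by
    obtain ⟨n, ι, hι⟩ := hX
    refine ⟨n, 𝒳.genericIso.hom ≫ ι, ?_⟩
    rw [Over.comp_left]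
    haveI : IsClosedImmersion ι.left := hι
    infer_instance
  filter_upwards [LocApprox.eventually_isProjective_snd_atPrime F 𝒳.total hgen] with w hw
  exact hw (HeightOneSpectrum.valuationSubringAtPrime F w)

end NumberField

end Literature.AlgebraicGeometry.Limits
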